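import Summits.BirchSwinnertonDyer.Rank1Residual.X11b.HeegnerIdealRamified
import Literature.NumberTheory.QuadraticFields.FundamentalDiscriminant
import Literature.NumberTheory.QuadraticFields.LatticeSumPrincipal
import HarnessLib

/-!
# The classical Heegner hypothesis `𝒪_K/𝔑 ≃ ℤ/Nℤ` — the converse direction: it FORCES every `q ∣ N` to split or to ramify with `q² ∤ N` (quadratic `K`)

HONEST FRAMING (cell `b2b-bsdres`, run/shared/lean/b2b/bsd-rank1-residual/, verbatim in every
file): the goal of the cell is to DELETE the COMBINATION-SHAPED residual classes of the
Birch–Swinnerton-Dyer formula for ALL analytic-rank `≤ 1` elliptic curves over `ℚ` — "full BSD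
formula for every rank `≤ 1` curve in class `C`" assembled STRICTLY from published theorems — so
that the rank-`≤ 1` remainder becomes exactly the CONSTRUCTION-SHAPED classes, which are TYPED
(missing-input `Prop`s), NOT attempted. This is not "finishing BSD". Sub-cell
`b2b-bsdres-multr1-p1` (X11b, route R1); no claim beyond the stated class; X11b stays
CONSTRUCTION-SHAPED; nothing here changes a label; no named fact (theorems only; no `sorry`).

## What this file kernel-checks, and why

[Cas20] = F. Castella, J. Inst. Math. Jussieu 19 (2020), §2.5 (version of record, author PDF p. 8;
also §1, p. 2) states: "(heeg) there is an ideal `𝔑 ⊂ 𝒪_K` with `𝒪_K/𝔑 ≃ ℤ/Nℤ`. The existence of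
such `𝔑` … AMOUNTS TO the requirement that every prime `q ∣ N` is either split or ramified in `K`,
with `q² ∤ N` in the latter case." `HeegnerIdealRamified.lean` proved "⟸". This file proves "⟹"
for a quadratic field, so that the typed hypothesis (heeg) of `Cas20Standing` (route R1,
`CastellaErratumVersionOfRecord.lean`) is EXACTLY Castella's prime-by-prime condition — neither
weaker nor stronger (`exists_ideal_quotient_ringEquiv_zmod_iff`):

* `exists_int_sub_mem_of_ringEquiv` — if `𝓞 K ⧸ 𝔑 ≃+* ZMod N` then every element of `𝓞 K` is
  congruent to a rational integer modulo `𝔑` (`𝓞 K = ℤ + 𝔑`); `absNorm_eq_of_ringEquiv` —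
  `N(𝔑) = N`;
* `exists_prime_inertiaDeg_eq_one_of_ringEquiv` — for a prime `q ∣ N` there is a prime `𝔔 ⊇ 𝔑`
  of `𝓞 K` above `q` with residue degree `f(𝔔|q) = 1` (`𝔔 ⊇ 𝔑 + q𝓞 K`, proper because `q` is
  not a unit in `ℤ/Nℤ`; `ℤ/q ↠ 𝓞 K/𝔔` because `ℤ ↠ 𝓞 K/𝔑`);
* `ncard_primesOver_eq_two_of_ringEquiv_of_not_dvd_discr` — if moreover `q ∤ d_K` then `q`
  SPLITS (unramified, so `e(𝔔|q) = 1`; the fundamental identity `∑ e f = 2` leaves room for a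
  second prime);
* `not_sq_dvd_of_ringEquiv_of_dvd_discr` — if `q ∣ d_K` (ramified) then `q² ∤ N`: with an integral
  basis `(1, ω)`, `ω² = m + tω`, `ω ≡ a (mod 𝔑)` for some `a ∈ ℤ`, so `N = N(𝔑) ∣ N(ω − a) =
  a² − ta − m` and `q² ∣ N` would give `q² ∣ 4(a² − ta − m) = (2a − t)² − d_K`; for odd `q ∣ d_K`
  this forces `q² ∣ d_K` (impossible, `not_sq_dvd_discr_of_prime_ne_two`), for `q = 2 ∣ d_K` it
  forces `d_K/4 ≡ □ (mod 4)`, against `d_K/4 ≡ 2, 3 (mod 4)` (`discr_div_four_emod_four`);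
* **`forall_split_or_ramified_of_ringEquiv`**, **`exists_ideal_quotient_ringEquiv_zmod_iff`** —
  the printed equivalence, both directions, for `[K : ℚ] = 2`, `N ≥ 1`.

No elliptic curve occurs here; pure algebraic number theory of quadratic fields (Marcus, *Number
Fields*, Ch. 3; Cox, *Primes of the form x² + ny²*, §7). Consumer: the bookkeeping remark that
R1's auxiliary-field shape is forced by (heeg) at the tame level (`CastellaErratumVersionOfRecord`).

References: [Castella2020JIMJ] §1 (p. 2), §2.5 (p. 8); [Gross1984] §3; [Darmon2004] Prop. 3.8;
D. A. Marcus, *Number Fields*, Ch. 2 Thm. 1, Ch. 3 Thms. 21, 24, 25.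
-/

noncomputable section

open scoped Classical

namespace Summit.BirchSwinnertonDyer.Rank1Residual.X11b.HeegnerIdeal

open Ideal NumberField Module

variable {K : Type*} [Field K] [NumberField K]

/-! ### `𝓞 K = ℤ + 𝔑` and `N(𝔑) = N` -/

omit [NumberField K] in
/-- If `𝓞 K ⧸ 𝔑 ≃+* ℤ/Nℤ` then every `x ∈ 𝓞 K` is congruent modulo `𝔑` to a rational integer
(the class of `x` is the class of the integer `e(x̄).val`). [folklore] -/
theorem exists_int_sub_mem_of_ringEquiv {N : ℕ} [NeZero N] {𝔑 : Ideal (𝓞 K)}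
    (e : 𝓞 K ⧸ 𝔑 ≃+* ZMod N) (x : 𝓞 K) : ∃ a : ℤ, x - (a : 𝓞 K) ∈ 𝔑 := by
  refine ⟨((e (Ideal.Quotient.mk 𝔑 x)).val : ℤ), ?_⟩
  rw [← Ideal.Quotient.eq, Int.cast_natCast, map_natCast]
  apply e.injective
  rw [map_natCast, ZMod.natCast_zmod_val]

/-- If `𝓞 K ⧸ 𝔑 ≃+* ℤ/Nℤ` then the absolute norm of `𝔑` is `N`. [folklore] -/
theorem absNorm_eq_of_ringEquiv {N : ℕ} {𝔑 : Ideal (𝓞 K)} (e : 𝓞 K ⧸ 𝔑 ≃+* ZMod N) :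
    absNorm 𝔑 = N := by
  rw [absNorm_apply, Submodule.cardQuot_apply, Nat.card_congr e.toEquiv, Nat.card_zmod]

/-! ### A prime of residue degree one above every `q ∣ N` -/

/-- **A prime `𝔔 ⊇ 𝔑` above `q` with `f(𝔔|q) = 1`, for every prime `q ∣ N`, when
`𝓞 K ⧸ 𝔑 ≃+* ℤ/Nℤ`.** The ideal `𝔑 + q𝓞 K` is proper (else `q` would be a unit of `ℤ/Nℤ`, but
`q ∣ N`), so it lies in a maximal `𝔔`, which contains `q`, hence lies over `(q)`; and
`ℤ/qℤ → 𝓞 K/𝔔` is a bijection (injective from a field, surjective because `𝓞 K = ℤ + 𝔑`), so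
`#(𝓞 K/𝔔) = q = q^{f(𝔔|q)}`. (Marcus, *Number Fields*, Ch. 3.) [folklore] -/
theorem exists_prime_inertiaDeg_eq_one_of_ringEquiv {N : ℕ} (hN : N ≠ 0) {𝔑 : Ideal (𝓞 K)}
    (e : 𝓞 K ⧸ 𝔑 ≃+* ZMod N) {q : ℕ} (hq : q.Prime) (hqN : q ∣ N) :
    ∃ Q : Ideal (𝓞 K), Q.IsPrime ∧ Q.LiesOver (span {(q : ℤ)}) ∧ 𝔑 ≤ Q ∧
      inertiaDeg' (span {(q : ℤ)}) Q = 1 := by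
  haveI : NeZero N := ⟨hN⟩
  have hqZ : Prime (q : ℤ) := Nat.prime_iff_prime_int.mp hq
  -- `J = 𝔑 + (q)` is a proper ideal
  set J : Ideal (𝓞 K) := 𝔑 ⊔ span {(q : 𝓞 K)} with hJ
  have hJtop : J ≠ ⊤ := by
    intro htop
    have h1 : (1 : 𝓞 K) ∈ J := by rw [htop]; exact Submodule.mem_top
    rw [hJ, Submodule.mem_sup] at h1
    obtain ⟨n, hn, y, hy, hny⟩ := h1
    obtain ⟨c, rfl⟩ := Ideal.mem_span_singleton'.mp hy
    -- modulo `𝔑`: `c * q = 1`, so `q` is a unit in `ℤ/Nℤ`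
    have hmk : Ideal.Quotient.mk 𝔑 (c * (q : 𝓞 K)) = 1 := by
      have : Ideal.Quotient.mk 𝔑 (n + c * (q : 𝓞 K)) = Ideal.Quotient.mk 𝔑 1 := by rw [hny]
      rwa [map_add, Ideal.Quotient.eq_zero_iff_mem.mpr hn, zero_add, map_one] at this
    have hunit : IsUnit ((q : ℕ) : ZMod N) := by
      have h2 : e (Ideal.Quotient.mk 𝔑 c) * (q : ZMod N) = 1 := by
        simpa [map_mul, map_natCast] using congrArg e hmk
      exact isUnit_iff_exists_inv.mpr ⟨_, by rw [mul_comm]; exact h2⟩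
    rw [ZMod.isUnit_iff_coprime] at hunit
    exact hq.one_lt.ne' (Nat.Coprime.eq_one_of_dvd hunit hqN)
  obtain ⟨Q, hQmax, hJQ⟩ := Ideal.exists_le_maximal J hJtop
  have hNQ : 𝔑 ≤ Q := le_trans le_sup_left hJQ
  have hqQ : (q : 𝓞 K) ∈ Q := hJQ (Ideal.mem_sup_right (Ideal.mem_span_singleton_self _))
  -- `Q` lies over `(q)`
  have hqmax : (span {(q : ℤ)} : Ideal ℤ).IsMaximal :=
    ((span_singleton_prime (Int.natCast_ne_zero.mpr hq.ne_zero)).mpr hqZ).isMaximal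
      (by simpa using (Int.natCast_ne_zero.mpr hq.ne_zero))
  have hle : span {(q : ℤ)} ≤ Q.under ℤ := by
    rw [Ideal.span_singleton_le_iff_mem, Ideal.under_def, Ideal.mem_comap, map_natCast]
    exact hqQ
  have hunder : span {(q : ℤ)} = Q.under ℤ :=
    hqmax.eq_of_le (Ideal.comap_ne_top _ hQmax.ne_top) hle
  haveI hQo : Q.LiesOver (span {(q : ℤ)}) := ⟨hunder⟩
  haveI := hQmax.isPrime
  -- `ℤ/q ≃ 𝓞 K/Q`, so `#(𝓞 K/Q) = q`
  haveI : Nontrivial (𝓞 K ⧸ Q) := Ideal.Quotient.nontrivial_iff.mpr hQmax.ne_top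
  haveI : (span {(q : ℤ)} : Ideal ℤ).IsMaximal := hqmax
  letI : Field (ℤ ⧸ span {(q : ℤ)}) := Ideal.Quotient.field _
  let f : ℤ ⧸ span {(q : ℤ)} →+* 𝓞 K ⧸ Q :=
    Ideal.quotientMap Q (algebraMap ℤ (𝓞 K)) (by rw [← Ideal.under_def]; exact hle)
  have hfinj : Function.Injective f := f.injective
  have hfsurj : Function.Surjective f := by
    intro y
    obtain ⟨x, rfl⟩ := Ideal.Quotient.mk_surjective y
    obtain ⟨a, ha⟩ := exists_int_sub_mem_of_ringEquiv e x
    refine ⟨Ideal.Quotient.mk _ a, ?_⟩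
    rw [Ideal.quotientMap_mk, eq_comm, Ideal.Quotient.eq]
    simpa using hNQ ha
  have hcard : Nat.card (𝓞 K ⧸ Q) = q := by
    rw [← Nat.card_congr (Equiv.ofBijective f ⟨hfinj, hfsurj⟩),
      Nat.card_congr (Int.quotientSpanNatEquivZMod q).toEquiv, Nat.card_zmod]
  have hf1 : inertiaDeg' (span {(q : ℤ)}) Q = 1 := by
    have h := Ideal.absNorm_eq_pow_inertiaDeg' Q hq
    rw [absNorm_apply, Submodule.cardQuot_apply, hcard] at h
    have := Nat.pow_right_injective hq.two_le (show q ^ 1 = q ^ inertiaDeg' (span {(q : ℤ)}) Q by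
      rw [pow_one]; exact h)
    exact this.symm
  exact ⟨Q, hQmax.isPrime, hQo, hNQ, hf1⟩

/-! ### Unramified `q ∣ N` splits -/

/-- **An unramified prime `q ∣ N` SPLITS when `𝓞 K ⧸ 𝔑 ≃+* ℤ/Nℤ`** (`[K : ℚ] = 2`): the prime
`𝔔` above `q` with `f = 1` has `e = 1` as well (`q ∤ d_K`, Dedekind), and `∑_{𝔓 ∣ q} e f = 2`
forces a second prime. [folklore] -/
theorem ncard_primesOver_eq_two_of_ringEquiv_of_not_dvd_discr (h2 : finrank ℚ K = 2) {N : ℕ}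
    (hN : N ≠ 0) {𝔑 : Ideal (𝓞 K)} (e : 𝓞 K ⧸ 𝔑 ≃+* ZMod N) {q : ℕ} (hq : q.Prime)
    (hqN : q ∣ N) (hd : ¬ (q : ℤ) ∣ NumberField.discr K) :
    ((span {(q : ℤ)}).primesOver (𝓞 K)).ncard = 2 := by
  have hqZ : Prime (q : ℤ) := Nat.prime_iff_prime_int.mp hq
  set p : Ideal ℤ := span {(q : ℤ)} with hp
  have hp0 : p ≠ ⊥ := by simpa [hp] using (Int.natCast_ne_zero.mpr hq.ne_zero)
  haveI hpmax : p.IsMaximal :=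
    ((span_singleton_prime (Int.natCast_ne_zero.mpr hq.ne_zero)).mpr hqZ).isMaximal hp0
  obtain ⟨Q, hQ, hQo, -, hfQ⟩ := exists_prime_inertiaDeg_eq_one_of_ringEquiv hN e hq hqN
  haveI := hQ
  haveI := hQo
  -- unramified: `e(Q|q) = 1`
  have hunr : Algebra.IsUnramifiedIn (𝓞 K) p :=
    (NumberField.not_dvd_discr_iff_isUnramifiedIn K (𝓞 K) hqZ).mp hd
  have heQ : ramificationIdx' p Q = 1 := by
    rw [Ideal.ramificationIdx'_eq_ramificationIdx p Q hp0]
    exact (Algebra.isUnramifiedIn_iff_forall_ramificationIdx_eq_one.mp hunr) Q hQo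
  -- the fundamental identity
  have hsum := Ideal.sum_ramification_inertia (R := ℤ) (𝓞 K) ℚ K (p := p) hp0
  rw [h2] at hsum
  set s := IsDedekindDomain.primesOverFinset p (𝓞 K) with hs
  have hQs : Q ∈ s := (IsDedekindDomain.mem_primesOverFinset_iff hp0 (𝓞 K)).mpr ⟨hQ, hQo⟩
  have hge : ∀ P ∈ s, 1 ≤ ramificationIdx' p P * inertiaDeg' p P := fun P hP ↦ by
    obtain ⟨hP1, hP2⟩ := (IsDedekindDomain.mem_primesOverFinset_iff hp0 (𝓞 K)).mp hP
    exact Right.one_le_mul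
      (Nat.pos_of_ne_zero (IsDedekindDomain.ramificationIdx'_ne_zero_of_liesOver P hp0))
      (Nat.pos_of_ne_zero (inertiaDeg'_ne_zero p P))
  -- `card s ≤ 2`
  have hle2 : s.card ≤ 2 := by
    rw [Finset.card_eq_sum_ones, ← hsum]
    exact Finset.sum_le_sum hge
  -- `card s ≥ 2`: otherwise `s = {Q}` and the sum is `e(Q) f(Q) = 1`
  have hge2 : 2 ≤ s.card := by
    by_contra hlt
    have hs1 : s = {Q} := by
      apply Finset.eq_singleton_iff_unique_mem.mpr
      refine ⟨hQs, fun P hP ↦ ?_⟩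
      by_contra hne
      have : 2 ≤ s.card := Finset.one_lt_card_iff.mpr ⟨P, Q, hP, hQs, hne⟩
      exact hlt this
    rw [hs1, Finset.sum_singleton, heQ, hfQ] at hsum
    omega
  have hcard : s.card = 2 := le_antisymm hle2 hge2
  rw [← IsDedekindDomain.coe_primesOverFinset hp0 (𝓞 K), Set.ncard_coe_finset]
  exact hcard

/-! ### Ramified `q ∣ N` has `q² ∤ N` -/

/-- **A ramified prime `q ∣ N` has `q² ∤ N` when `𝓞 K ⧸ 𝔑 ≃+* ℤ/Nℤ`** (`[K : ℚ] = 2`). With an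
integral basis `(1, ω)`, `ω² = m + tω`, `d_K = t² + 4m`: `ω ≡ a (mod 𝔑)` for an integer `a`, so
`N = N(𝔑)` divides `N(ω − a) = a² − ta − m`; if `q² ∣ N` then `q² ∣ (2a − t)² − d_K`. For odd
`q ∣ d_K` this gives `q ∣ 2a − t` and `q² ∣ d_K`, impossible (`not_sq_dvd_discr_of_prime_ne_two`);
for `q = 2 ∣ d_K` it gives `2a − t = 2u` and `d_K/4 ≡ u² (mod 4)`, impossible since
`d_K/4 ≡ 2, 3 (mod 4)` (`discr_div_four_emod_four`). (Marcus, *Number Fields*, Ch. 2 Thm. 1; Cox §7.A.)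
[folklore] -/
theorem not_sq_dvd_of_ringEquiv_of_dvd_discr (h2 : finrank ℚ K = 2) {N : ℕ} (hN : N ≠ 0)
    {𝔑 : Ideal (𝓞 K)} (e : 𝓞 K ⧸ 𝔑 ≃+* ZMod N) {q : ℕ} (hq : q.Prime) (hqN : q ∣ N)
    (hd : (q : ℤ) ∣ NumberField.discr K) : ¬ q ^ 2 ∣ N := by
  haveI : NeZero N := ⟨hN⟩
  intro hq2N
  obtain ⟨b, hb⟩ := Literature.NumberTheory.QuadraticFields.Quadratic.exists_basis_zero_eq_one h2
  set t : ℤ := b.repr (b 1 * b 1) 1 with ht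
  set m : ℤ := b.repr (b 1 * b 1) 0 with hm
  have hωω : b 1 * b 1 = (m : 𝓞 K) + (t : 𝓞 K) * b 1 :=
    Literature.NumberTheory.QuadraticFields.Quadratic.basis_one_mul_self_eq b hb
  have hdK : NumberField.discr K = t ^ 2 + 4 * m :=
    Literature.NumberTheory.QuadraticFields.Quadratic.discr_eq_sq_add_four_mul b hb
  -- `ω ≡ a (mod 𝔑)`
  obtain ⟨a, ha⟩ := exists_int_sub_mem_of_ringEquiv e (b 1)
  set θ : 𝓞 K := ((-a : ℤ) : 𝓞 K) + ((1 : ℤ) : 𝓞 K) * b 1 with hθ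
  have hθ' : θ = b 1 - (a : 𝓞 K) := by rw [hθ]; push_cast; ring
  have hθmem : θ ∈ 𝔑 := by rw [hθ']; exact ha
  -- `N ∣ N(θ) = a² − ta − m`
  have hnorm : Algebra.norm ℤ θ = (-a) ^ 2 + t * (-a) * 1 - m * 1 ^ 2 :=
    Literature.NumberTheory.QuadraticFields.Quadratic.norm_intCast_add_intCast_mul b hb hωω (-a) 1
  have hdvd : (N : ℤ) ∣ Algebra.norm ℤ θ := by
    have h1 : absNorm 𝔑 ∣ absNorm (span {θ}) :=
      Ideal.absNorm_dvd_absNorm_of_le ((Ideal.span_singleton_le_iff_mem _).mpr hθmem)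
    rw [absNorm_eq_of_ringEquiv e, Ideal.absNorm_span_singleton] at h1
    exact Int.dvd_natAbs.mp (Int.natCast_dvd_natCast.mpr h1)
  have hq2 : ((q : ℤ) ^ 2) ∣ (2 * a - t) ^ 2 - NumberField.discr K := by
    have h1 : ((q : ℤ) ^ 2) ∣ (N : ℤ) := by exact_mod_cast hq2N
    have h2' : ((q : ℤ) ^ 2) ∣ 4 * Algebra.norm ℤ θ := (h1.trans hdvd).mul_left 4
    have h3 : 4 * Algebra.norm ℤ θ = (2 * a - t) ^ 2 - NumberField.discr K := by
      rw [hnorm, hdK]; ring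
    rwa [h3] at h2'
  have hqZ : Prime (q : ℤ) := Nat.prime_iff_prime_int.mp hq
  by_cases hq_two : q = 2
  · -- `q = 2`: `t = 2k`, `d_K/4 = k² + m ≡ (a − k)² (mod 4)` contradicts `d_K/4 ≡ 2, 3 (mod 4)`
    subst hq_two
    have h2d : (2 : ℤ) ∣ NumberField.discr K := by exact_mod_cast hd
    have h4N : (4 : ℤ) ∣ Algebra.norm ℤ θ := by
      have h1 : ((4 : ℕ) : ℤ) ∣ (N : ℤ) := by exact_mod_cast hq2N
      exact h1.trans hdvd
    -- `t` is even
    have h2t : (2 : ℤ) ∣ t := by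
      have h1 : (2 : ℤ) ∣ t ^ 2 := by
        have : (2 : ℤ) ∣ t ^ 2 + 4 * m := hdK ▸ h2d
        exact (Int.dvd_add_left (dvd_mul_of_dvd_left (by norm_num) m)).mp this
      exact Int.prime_two.dvd_of_dvd_pow h1
    obtain ⟨k, hk⟩ := h2t
    have h4d : (4 : ℤ) ∣ NumberField.discr K := ⟨k ^ 2 + m, by rw [hdK, hk]; ring⟩
    have hD4 : NumberField.discr K / 4 = k ^ 2 + m := by
      rw [hdK, hk, show (2 * k) ^ 2 + 4 * m = 4 * (k ^ 2 + m) by ring, Int.mul_ediv_cancel_left _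
        (by norm_num)]
    have hmod := Literature.NumberTheory.QuadraticFields.Quadratic.discr_div_four_emod_four h2
      (by exact_mod_cast h4d)
    rw [hD4] at hmod
    -- `4 ∣ (a − k)² − (k² + m)`
    have h4' : (4 : ℤ) ∣ (a - k) ^ 2 - (k ^ 2 + m) := by
      have : (a - k) ^ 2 - (k ^ 2 + m) = Algebra.norm ℤ θ := by rw [hnorm, hk]; ring
      rw [this]; exact h4N
    have hz : (((a - k) ^ 2 - (k ^ 2 + m) : ℤ) : ZMod 4) = 0 :=
      (ZMod.intCast_zmod_eq_zero_iff_dvd _ 4).mpr h4'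
    have hsq : ((a - k : ℤ) : ZMod 4) ^ 2 = ((k ^ 2 + m : ℤ) : ZMod 4) := by
      rw [← sub_eq_zero]; exact_mod_cast hz
    have hval : ((k ^ 2 + m : ℤ) : ZMod 4) = 2 ∨ ((k ^ 2 + m : ℤ) : ZMod 4) = 3 := by
      rcases hmod with h | h
      · left
        have h4 : (4 : ℤ) ∣ (k ^ 2 + m) - 2 := by
          generalize k ^ 2 + m = X at h ⊢
          omega
        have h5 := (ZMod.intCast_zmod_eq_zero_iff_dvd ((k ^ 2 + m) - 2) 4).mpr h4
        rw [Int.cast_sub, sub_eq_zero] at h5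
        exact_mod_cast h5
      · right
        have h4 : (4 : ℤ) ∣ (k ^ 2 + m) - 3 := by
          generalize k ^ 2 + m = X at h ⊢
          omega
        have h5 := (ZMod.intCast_zmod_eq_zero_iff_dvd ((k ^ 2 + m) - 3) 4).mpr h4
        rw [Int.cast_sub, sub_eq_zero] at h5
        exact_mod_cast h5
    have key : ∀ x : ZMod 4, x ^ 2 ≠ 2 ∧ x ^ 2 ≠ 3 := by decide
    rcases hval with h | h
    · exact (key _).1 (hsq.trans h)
    · exact (key _).2 (hsq.trans h)
  · -- odd `q`: `q² ∣ d_K`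
    have hqd : (q : ℤ) ∣ (2 * a - t) := by
      have h1 : (q : ℤ) ∣ (2 * a - t) ^ 2 - NumberField.discr K :=
        dvd_trans (dvd_pow_self _ two_ne_zero) hq2
      have h2' : (q : ℤ) ∣ (2 * a - t) ^ 2 := by
        have := dvd_add h1 hd
        simpa using this
      exact hqZ.dvd_of_dvd_pow h2'
    have hsq : ((q : ℤ) ^ 2) ∣ NumberField.discr K := by
      have h1 : ((q : ℤ) ^ 2) ∣ (2 * a - t) ^ 2 := pow_dvd_pow_of_dvd hqd 2
      have := dvd_sub h1 hq2
      simpa using this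
    exact Literature.NumberTheory.QuadraticFields.Quadratic.not_sq_dvd_discr_of_prime_ne_two h2 hq
      hq_two hsq

/-! ### The printed equivalence -/

/-- **(heeg) ⟹ "every `q ∣ N` split, or ramified with `q² ∤ N`"** (`[K : ℚ] = 2`, `N ≥ 1`): the
direction "⟹" of [Cas20, §2.5]'s "The existence of such `𝔑` … amounts to the requirement that
every prime `q ∣ N` is either split or ramified in `K`, with `q² ∤ N` in the latter case".
[cite: Castella2020JIMJ, §2.5 (author PDF p. 8), the sentence following (heeg)] -/
theorem forall_split_or_ramified_of_ringEquiv (h2 : finrank ℚ K = 2) {N : ℕ} (hN : N ≠ 0)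
    {𝔑 : Ideal (𝓞 K)} (e : 𝓞 K ⧸ 𝔑 ≃+* ZMod N) :
    ∀ q : ℕ, q.Prime → q ∣ N →
      ((span {(q : ℤ)}).primesOver (𝓞 K)).ncard = 2 ∨
        ((q : ℤ) ∣ NumberField.discr K ∧ ¬ q ^ 2 ∣ N) := by
  intro q hq hqN
  by_cases hd : (q : ℤ) ∣ NumberField.discr K
  · exact Or.inr ⟨hd, not_sq_dvd_of_ringEquiv_of_dvd_discr h2 hN e hq hqN hd⟩
  · exact Or.inl (ncard_primesOver_eq_two_of_ringEquiv_of_not_dvd_discr h2 hN e hq hqN hd)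

/-- **[Cas20, §2.5]'s equivalence, kernel-checked for quadratic fields**: for `[K : ℚ] = 2` and
`N ≥ 1`, there is an ideal `𝔑 ⊂ 𝓞 K` with `𝓞 K ⧸ 𝔑 ≃ ℤ/Nℤ` if and only if every prime `q ∣ N`
either splits in `K` or is ramified with `q² ∤ N` ("The existence of such `𝔑` … amounts to the
requirement that every prime `q|N` is either split or ramified in `K`, with `q² ∤ N` in the latter
case", author PDF p. 8; §1 p. 2 "equivalently"). "⟸" is
`exists_ideal_quotient_ringEquiv_zmod_of_split_or_ramified`, "⟹" is
`forall_split_or_ramified_of_ringEquiv`. (Gross 1984 §3; Darmon 2004 Prop. 3.8 for `(d_K, N) = 1`.)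
[cite: Castella2020JIMJ, §2.5 (author PDF p. 8), hypothesis (heeg) and the sentence following it]
[cite: Gross1984, §3] -/
theorem exists_ideal_quotient_ringEquiv_zmod_iff (h2 : finrank ℚ K = 2) {N : ℕ} (hN : N ≠ 0) :
    (∃ 𝔑 : Ideal (𝓞 K), Nonempty (𝓞 K ⧸ 𝔑 ≃+* ZMod N)) ↔
      ∀ q : ℕ, q.Prime → q ∣ N →
        ((span {(q : ℤ)}).primesOver (𝓞 K)).ncard = 2 ∨
          ((q : ℤ) ∣ NumberField.discr K ∧ ¬ q ^ 2 ∣ N) := by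
  constructor
  · rintro ⟨𝔑, ⟨e⟩⟩
    exact forall_split_or_ramified_of_ringEquiv h2 hN e
  · exact exists_ideal_quotient_ringEquiv_zmod_of_split_or_ramified h2 hN

end Summit.BirchSwinnertonDyer.Rank1Residual.X11b.HeegnerIdeal

end
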